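/-
Copyright (c) 2026 the pub-hodgecm-mathlib formalisation cell (harness21).  Prover seat hodgecm-mathlib-A-p19 (g19), topic T5 = P8
«(C♯)hol interior», node Cc (J-plc) brick (iii) (desk F0P2-plan (g8) «=» 20:14:40Z: report-first).  KERNEL: theorems only.
-/
import Literature.NumberTheory.GelbartRogawski1991.DoubledWeilRepresentationArchPlaceElement
import HarnessLib

/-!
# The vacuum coefficient of Folland's section at the one-place element `k_{v₀,u}`: `vac = 1` (pair form positive at `v₀`) or
# `vac = ((det u)^M)⁻¹` (negative at `v₀`) ([Folland1989, Prop. (4.39)]; [KonnoKonno2007, Lem. 5.2])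

Topic `NumberTheory/GelbartRogawski1991`; namespace `Literature.NumberTheory.GelbartRogawski1991.GRConstruction`.  KERNEL ONLY: proved theorems;
0 definitions, 0 records, 0 `sorry`.  Sequel of `DoubledWeilRepresentationArchPlaceElement` (brick (ii): the element `k_{v₀,u} = ((u at w(v₀)) ⊗ 1_W) ⊕ 1`,
its place components, `η_t`, sign-block compactness) and the analogue of ★ `vac_sectionD_archK` of `…ArchVacuumUndoubling` for the one-place
element: Folland's vacuum coefficient is `(∏_v det b_v)⁻¹` (★ `vac_archWeilSectionS_of_kV`), `b_v` the NEGATIVE sign block of the place component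
(★ p832922 `det_of_archUFormPi_eq_kV_of_sign_separated`: `det b_v = det (M_v|_{Q_v × Q_v})`); here `M_v = 1` for `v ≠ v₀`, and at `v₀` the negative
block is the `−𝕍` copy (`= 1`) when the pair form is POSITIVE at `v₀`, the `𝕍` copy (`= u ⊗ 1_W`, determinant `(det u)^M`) when it is NEGATIVE.

* `det_negSubmatrix_archKPlace_of_ne ∕ _of_pos ∕ _of_neg` — the three determinants;
* **`vac_sectionD_archKPlace_of_pos`** (`vac = 1`) and **`vac_sectionD_archKPlace_of_neg`** (`vac = ((det u)^M)⁻¹`).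

With ★ `coe_etaD_archKPlace` (`η_t = ((det u)^M)^{(t_{w(v₀)}+1)/2}`) the Gaussian eigenvalue `η_t · vac` of the doubled explicit half at `k_{v₀,u}` is
`((det u)^M)^{(t+1)/2}` resp. `((det u)^M)^{(t−1)/2}` — [KonnoKonno2007, Lem. 5.2]'s `m = (t ± 1)/2` read at one definite place (the (J-plc-G) sequel
undoubles it to `ω(ι_χ(archSingle u, 1))` on `G_𝕍 ⊗ f`).  HC_CM is NOT proved here or anywhere in the tree.

References: [Folland1989] §4.2 Prop. (4.39); [KonnoKonno2007] §3.1, Lemma 5.2; [Kudla1994] §2.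
-/

set_option autoImplicit false

noncomputable section

open scoped Classical
open scoped Matrix Kronecker
open NumberField NumberField.InfinitePlace NumberField.mixedEmbedding IsDedekindDomain
open Literature.NumberTheory.Automorphic Literature.NumberTheory.Automorphic.UnitaryGroup
open Literature.NumberTheory.Weil1964

namespace Literature.NumberTheory.GelbartRogawski1991.GRConstruction

open UnitaryDualPair
open Literature.NumberTheory.GelbartRogawski1991.UnitaryDualPair.LocalSplitting
open Literature.RepresentationTheory.KonnoKonno2007 Literature.RepresentationTheory.KonnoKonno2007.RealDualPair
open Literature.Analysis.SegalBargmann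

variable (L : Type) [Field L] [NumberField L] [IsCMField L]

variable {N M n : ℕ} (e : Fin N × Fin M ≃ Fin n)
  (dV : Fin N → L) (hdV : ∀ i, IsCMField.complexConj L (dV i) = dV i) (hdV0 : ∀ i, dV i ≠ 0)
  (dW : Fin M → L) (hdW : ∀ i, IsCMField.complexConj L (dW i) = dW i) (hdW0 : ∀ i, dW i ≠ 0)
  (v₀ : {v : InfinitePlace (Fp L) // v.IsReal}) (u : UnitaryGroup.archLocal L N (Matrix.diagonal dV) (cmPlaceOver L v₀))

/-! ## §1 The negative-block determinants of the place components of `k_{v₀,u}` -/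

/-- **away from `v₀` the place component of `k_{v₀,u}` is `1`.** [cite: BorelJacquet1979, §4.1] -/
theorem coe_archAt_archKPlace_of_ne {v : {v : InfinitePlace (Fp L) // v.IsReal}} (hv : v ≠ v₀) :
    (((UnitaryGroup.archAt (Fp L) L (IsCMField.complexConj L) (n + n) (hermD L e dV hdV dW hdW) (cmPlaceOver L v) (cmPlaceOver_smul L v)
        (IsCMField.complexConj_ne_one L) (archKPlace L e dV hdV dW hdW v₀ u) :
        UnitaryGroup.archLocal L (n + n) (hermD L e dV hdV dW hdW) (cmPlaceOver L v)) : GL (Fin (n + n)) ℂ) : Matrix (Fin (n + n)) (Fin (n + n)) ℂ) = 1 := by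
  have hne : cmPlaceOver L v ≠ cmPlaceOver L v₀ := fun h => hv (Subtype.ext (by
    rw [← cmPlaceOver_comap L v, ← cmPlaceOver_comap L v₀, h]))
  rw [coe_archAt_archKPlace]
  erw [UnitaryGroup.archAt_archSingle_of_ne (Fp L) L (IsCMField.complexConj L) N (Matrix.diagonal dV)
    (IsCMField.complexConj_ne_one L) (complexConj_smul_infinitePlace L) (cmPlaceOver L v₀) hne u]
  rw [OneMemClass.coe_one, Units.val_one, Matrix.one_kronecker_one]
  simp only [Matrix.reindex_apply, Matrix.submatrix_one_equiv, Matrix.fromBlocks_one]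

/-- **away from `v₀`: the negative-block determinant is `1`.** [cite: Folland1989, §4.2 Prop. (4.39)] -/
theorem det_negSubmatrix_archKPlace_of_ne {v : {v : InfinitePlace (Fp L) // v.IsReal}} (hv : v ≠ v₀) :
    ((((UnitaryGroup.archAt (Fp L) L (IsCMField.complexConj L) (n + n) (hermD L e dV hdV dW hdW) (cmPlaceOver L v) (cmPlaceOver_smul L v)
        (IsCMField.complexConj_ne_one L) (archKPlace L e dV hdV dW hdW v₀ u) :
        UnitaryGroup.archLocal L (n + n) (hermD L e dV hdV dW hdW) (cmPlaceOver L v)) : GL (Fin (n + n)) ℂ) : Matrix (Fin (n + n)) (Fin (n + n)) ℂ).submatrix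
      (fun q : NegIdx (signVec (cmPlaceOver L) (entryD L e dV hdV dW hdW) (imagUnit L) v) => q.1) (fun q : NegIdx (signVec (cmPlaceOver L) (entryD L e dV hdV dW hdW) (imagUnit L) v) => q.1)).det = 1 := by
  rw [coe_archAt_archKPlace_of_ne L e dV hdV dW hdW v₀ u hv]
  have h1 : ((1 : Matrix (Fin (n + n)) (Fin (n + n)) ℂ).submatrix
      (fun q : NegIdx (signVec (cmPlaceOver L) (entryD L e dV hdV dW hdW) (imagUnit L) v) => q.1) (fun q : NegIdx (signVec (cmPlaceOver L) (entryD L e dV hdV dW hdW) (imagUnit L) v) => q.1)) = 1 := by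
    ext q q'
    simp only [Matrix.submatrix_apply, Matrix.one_apply, Subtype.ext_iff]
  rw [h1, Matrix.det_one]

/-- **at `v₀`, pair form POSITIVE there: the negative block is the `−𝕍` copy, determinant `1`.** [cite: Folland1989, §4.2 Prop. (4.39)]
[cite: KonnoKonno2007, Lem. 5.2] -/
theorem det_negSubmatrix_archKPlace_of_pos (hpos : ∀ k : Fin n, 0 < signVec (cmPlaceOver L) (cmGramEntry L e dV hdV dW hdW) (imagUnit L) v₀ k) :
    ((((UnitaryGroup.archAt (Fp L) L (IsCMField.complexConj L) (n + n) (hermD L e dV hdV dW hdW) (cmPlaceOver L v₀) (cmPlaceOver_smul L v₀)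
        (IsCMField.complexConj_ne_one L) (archKPlace L e dV hdV dW hdW v₀ u) :
        UnitaryGroup.archLocal L (n + n) (hermD L e dV hdV dW hdW) (cmPlaceOver L v₀)) : GL (Fin (n + n)) ℂ) : Matrix (Fin (n + n)) (Fin (n + n)) ℂ).submatrix
      (fun q : NegIdx (signVec (cmPlaceOver L) (entryD L e dV hdV dW hdW) (imagUnit L) v₀) => q.1) (fun q : NegIdx (signVec (cmPlaceOver L) (entryD L e dV hdV dW hdW) (imagUnit L) v₀) => q.1)).det = 1 := by
  -- every negative index lies in the second copy
  have hq : ∀ q : NegIdx (signVec (cmPlaceOver L) (entryD L e dV hdV dW hdW) (imagUnit L) v₀), ∃ a : Fin n, q.1 = (e₂ (n := n)) (Sum.inr a) := by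
    rintro ⟨k, hk⟩
    obtain ⟨x, rfl⟩ := (e₂ (n := n)).surjective k
    rcases x with a | a
    · rw [signVec_doubled_inl] at hk; exact absurd (hpos a) hk
    · exact ⟨a, rfl⟩
  choose ρ hρ using hq
  have hρinj : Function.Injective ρ := fun q q' h => Subtype.ext (by rw [hρ q, hρ q', h])
  have h1 : ((((UnitaryGroup.archAt (Fp L) L (IsCMField.complexConj L) (n + n) (hermD L e dV hdV dW hdW) (cmPlaceOver L v₀) (cmPlaceOver_smul L v₀)
        (IsCMField.complexConj_ne_one L) (archKPlace L e dV hdV dW hdW v₀ u) :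
        UnitaryGroup.archLocal L (n + n) (hermD L e dV hdV dW hdW) (cmPlaceOver L v₀)) : GL (Fin (n + n)) ℂ) : Matrix (Fin (n + n)) (Fin (n + n)) ℂ).submatrix
      (fun q : NegIdx (signVec (cmPlaceOver L) (entryD L e dV hdV dW hdW) (imagUnit L) v₀) => q.1) (fun q : NegIdx (signVec (cmPlaceOver L) (entryD L e dV hdV dW hdW) (imagUnit L) v₀) => q.1)) = 1 := by
    ext q q'
    rw [Matrix.submatrix_apply, hρ q, hρ q', coe_archAt_archKPlace, Matrix.reindex_apply, Matrix.submatrix_apply, Equiv.symm_apply_apply,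
      Equiv.symm_apply_apply, Matrix.fromBlocks_apply₂₂, Matrix.one_apply, Matrix.one_apply]
    simp only [hρinj.eq_iff]
  rw [h1, Matrix.det_one]

include hdV0 hdW0 in
/-- **at `v₀`, pair form NEGATIVE there: the negative block is the `𝕍` copy `u ⊗ 1_W`, determinant `(det u)^M`.** [cite: Folland1989, §4.2 Prop. (4.39)]
[cite: KonnoKonno2007, Lem. 5.2] -/
theorem det_negSubmatrix_archKPlace_of_neg (hneg : ∀ k : Fin n, ¬ 0 < signVec (cmPlaceOver L) (cmGramEntry L e dV hdV dW hdW) (imagUnit L) v₀ k) :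
    ((((UnitaryGroup.archAt (Fp L) L (IsCMField.complexConj L) (n + n) (hermD L e dV hdV dW hdW) (cmPlaceOver L v₀) (cmPlaceOver_smul L v₀)
        (IsCMField.complexConj_ne_one L) (archKPlace L e dV hdV dW hdW v₀ u) :
        UnitaryGroup.archLocal L (n + n) (hermD L e dV hdV dW hdW) (cmPlaceOver L v₀)) : GL (Fin (n + n)) ℂ) : Matrix (Fin (n + n)) (Fin (n + n)) ℂ).submatrix
      (fun q : NegIdx (signVec (cmPlaceOver L) (entryD L e dV hdV dW hdW) (imagUnit L) v₀) => q.1) (fun q : NegIdx (signVec (cmPlaceOver L) (entryD L e dV hdV dW hdW) (imagUnit L) v₀) => q.1)).det =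
      ((((u : UnitaryGroup.archLocal L N (Matrix.diagonal dV) (cmPlaceOver L v₀)) : GL (Fin N) ℂ) : Matrix (Fin N) (Fin N) ℂ).det) ^ M := by
  -- the negative indices are exactly the first copy: `φ : Fin n ≃ NegIdx`
  have hmem : ∀ a : Fin n, ¬ 0 < signVec (cmPlaceOver L) (entryD L e dV hdV dW hdW) (imagUnit L) v₀ ((e₂ (n := n)) (Sum.inl a)) := fun a => by
    rw [signVec_doubled_inl]; exact hneg a
  have hsurj : ∀ q : NegIdx (signVec (cmPlaceOver L) (entryD L e dV hdV dW hdW) (imagUnit L) v₀), ∃ a : Fin n, q.1 = (e₂ (n := n)) (Sum.inl a) := by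
    rintro ⟨k, hk⟩
    obtain ⟨x, rfl⟩ := (e₂ (n := n)).surjective k
    rcases x with a | a
    · exact ⟨a, rfl⟩
    · rw [signVec_doubled_inr] at hk
      exact absurd (neg_pos.mpr (lt_of_le_of_ne (not_lt.mp (hneg a)) (signVec_ne_zero (IsCMField.complexConj_ne_one L) (cmPlaceOver_smul L)
        (complexConj_imagUnit L) (imagUnit_ne_zero L) (cmGramEntry_ne_zero L e dV hdV dW hdW hdV0 hdW0) v₀ a))) hk
  obtain ⟨φ, hφ⟩ : ∃ φ : Fin n ≃ NegIdx (signVec (cmPlaceOver L) (entryD L e dV hdV dW hdW) (imagUnit L) v₀),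
      ∀ a, (φ a).1 = (e₂ (n := n)) (Sum.inl a) :=
    ⟨Equiv.ofBijective (fun a => (⟨(e₂ (n := n)) (Sum.inl a), hmem a⟩ : NegIdx (signVec (cmPlaceOver L) (entryD L e dV hdV dW hdW) (imagUnit L) v₀)))
      ⟨fun a a' h => Sum.inl_injective ((e₂ (n := n)).injective (congrArg Subtype.val h)),
        fun q => by obtain ⟨a, ha⟩ := hsurj q; exact ⟨a, Subtype.ext ha.symm⟩⟩, fun a => rfl⟩
  rw [← Matrix.det_submatrix_equiv_self φ, Matrix.submatrix_submatrix]
  have h1 : ((((UnitaryGroup.archAt (Fp L) L (IsCMField.complexConj L) (n + n) (hermD L e dV hdV dW hdW) (cmPlaceOver L v₀) (cmPlaceOver_smul L v₀)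
        (IsCMField.complexConj_ne_one L) (archKPlace L e dV hdV dW hdW v₀ u) :
        UnitaryGroup.archLocal L (n + n) (hermD L e dV hdV dW hdW) (cmPlaceOver L v₀)) : GL (Fin (n + n)) ℂ) : Matrix (Fin (n + n)) (Fin (n + n)) ℂ).submatrix
      ((fun q : NegIdx (signVec (cmPlaceOver L) (entryD L e dV hdV dW hdW) (imagUnit L) v₀) => q.1) ∘ φ) ((fun q : NegIdx (signVec (cmPlaceOver L) (entryD L e dV hdV dW hdW) (imagUnit L) v₀) => q.1) ∘ φ)) =
      Matrix.reindex e e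
        ((((u : UnitaryGroup.archLocal L N (Matrix.diagonal dV) (cmPlaceOver L v₀)) : GL (Fin N) ℂ) : Matrix (Fin N) (Fin N) ℂ) ⊗ₖ
          (1 : Matrix (Fin M) (Fin M) ℂ)) := by
    ext a a'
    rw [Matrix.submatrix_apply, Function.comp_apply, Function.comp_apply, hφ a, hφ a']
    show (((UnitaryGroup.archAt (Fp L) L (IsCMField.complexConj L) (n + n) (hermD L e dV hdV dW hdW) (cmPlaceOver L v₀) (cmPlaceOver_smul L v₀)
        (IsCMField.complexConj_ne_one L) (archKPlace L e dV hdV dW hdW v₀ u) :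
        UnitaryGroup.archLocal L (n + n) (hermD L e dV hdV dW hdW) (cmPlaceOver L v₀)) : GL (Fin (n + n)) ℂ) : Matrix (Fin (n + n)) (Fin (n + n)) ℂ)
        ((e₂ (n := n)) (Sum.inl a)) ((e₂ (n := n)) (Sum.inl a')) = _
    rw [coe_archAt_archKPlace, Matrix.reindex_apply, Matrix.submatrix_apply, Equiv.symm_apply_apply, Equiv.symm_apply_apply,
      Matrix.fromBlocks_apply₁₁]
    erw [UnitaryGroup.archAt_archSingle_self (Fp L) L (IsCMField.complexConj L) N (Matrix.diagonal dV) (IsCMField.complexConj_ne_one L)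
      (complexConj_smul_infinitePlace L) (cmPlaceOver L v₀) u]
  rw [h1, Matrix.det_reindex_self, Matrix.det_kronecker, Matrix.det_one, one_pow, mul_one, Fintype.card_fin]

/-! ## §2 The vacuum coefficient of Folland's section at `k_{v₀,u}` -/

include hdV0 hdW0 in
/-- **pair form POSITIVE at `v₀`: `vac (sectionD k_{v₀,u}) = 1`.** [cite: Folland1989, §4.2 Prop. (4.39)] [cite: KonnoKonno2007, Lem. 5.2] -/
theorem vac_sectionD_archKPlace_of_pos (hpos : ∀ k : Fin n, 0 < signVec (cmPlaceOver L) (cmGramEntry L e dV hdV dW hdW) (imagUnit L) v₀ k) :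
    MpS.vac (sectionD L e dV hdV hdV0 dW hdW hdW0 (archKPlace L e dV hdV dW hdW v₀ u)) = 1 := by
  have hdef : ∀ k k' : Fin n, (0 < signVec (cmPlaceOver L) (cmGramEntry L e dV hdV dW hdW) (imagUnit L) v₀ k ↔
      0 < signVec (cmPlaceOver L) (cmGramEntry L e dV hdV dW hdW) (imagUnit L) v₀ k') := fun k k' => ⟨fun _ => hpos k', fun _ => hpos k⟩
  choose k hk hk1 hk2 using fun v => det_of_archUFormPi_eq_kV_of_sign_separated L (IsCMField.complexConj L) (n + n)
    (IsCMField.complexConj_ne_one L) (cmPlaceOver L) (cmPlaceOver_smul L) (cmPlaceOver_comap L) (entryD L e dV hdV dW hdW)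
    (gramD_gram_realDiagonal_entry_ne_zero L e dV hdV dW hdW hdV0 hdW0) (gramD_eq_diagonal_cm L e dV hdV dW hdW)
    (J := hermD L e dV hdV dW hdW) rfl (complexConj_imagUnit L) (imagUnit_ne_zero L) (archKPlace L e dV hdV dW hdW v₀ u) v
    (archAt_archKPlace_sign_separated L e dV hdV dW hdW v₀ u hdef v)
  rw [show MpS.vac (sectionD L e dV hdV hdV0 dW hdW hdW0 (archKPlace L e dV hdV dW hdW v₀ u)) = _ from
    vac_archWeilSectionS_of_kV L (IsCMField.complexConj L) (n + n) (IsCMField.complexConj_ne_one L) (cmPlaceOver L)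
      (cmPlaceOver_smul L) (cmPlaceOver_comap L) (entryD L e dV hdV dW hdW)
      (gramD_gram_realDiagonal_entry_ne_zero L e dV hdV dW hdW hdV0 hdW0) (gramD_eq_diagonal_cm L e dV hdV dW hdW)
      (J := hermD L e dV hdV dW hdW) rfl (complexConj_imagUnit L) (imagUnit_ne_zero L) (archKPlace L e dV hdV dW hdW v₀ u)
      (fun v => (k v).1) (fun v => (k v).2) (fun v => hk v)]
  rw [inv_eq_one]
  refine Finset.prod_eq_one fun v _ => ?_
  rw [hk2 v]
  by_cases hv : v = v₀
  · subst hv; exact det_negSubmatrix_archKPlace_of_pos L e dV hdV dW hdW v u hpos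
  · exact det_negSubmatrix_archKPlace_of_ne L e dV hdV dW hdW v₀ u hv

include hdV0 hdW0 in
/-- **pair form NEGATIVE at `v₀`: `vac (sectionD k_{v₀,u}) = ((det u)^M)⁻¹`.** [cite: Folland1989, §4.2 Prop. (4.39)] [cite: KonnoKonno2007, Lem. 5.2] -/
theorem vac_sectionD_archKPlace_of_neg (hneg : ∀ k : Fin n, ¬ 0 < signVec (cmPlaceOver L) (cmGramEntry L e dV hdV dW hdW) (imagUnit L) v₀ k) :
    MpS.vac (sectionD L e dV hdV hdV0 dW hdW hdW0 (archKPlace L e dV hdV dW hdW v₀ u)) =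
      (((((u : UnitaryGroup.archLocal L N (Matrix.diagonal dV) (cmPlaceOver L v₀)) : GL (Fin N) ℂ) : Matrix (Fin N) (Fin N) ℂ).det) ^ M)⁻¹ := by
  have hdef : ∀ k k' : Fin n, (0 < signVec (cmPlaceOver L) (cmGramEntry L e dV hdV dW hdW) (imagUnit L) v₀ k ↔
      0 < signVec (cmPlaceOver L) (cmGramEntry L e dV hdV dW hdW) (imagUnit L) v₀ k') :=
    fun k k' => ⟨fun h => absurd h (hneg k), fun h => absurd h (hneg k')⟩
  choose k hk hk1 hk2 using fun v => det_of_archUFormPi_eq_kV_of_sign_separated L (IsCMField.complexConj L) (n + n)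
    (IsCMField.complexConj_ne_one L) (cmPlaceOver L) (cmPlaceOver_smul L) (cmPlaceOver_comap L) (entryD L e dV hdV dW hdW)
    (gramD_gram_realDiagonal_entry_ne_zero L e dV hdV dW hdW hdV0 hdW0) (gramD_eq_diagonal_cm L e dV hdV dW hdW)
    (J := hermD L e dV hdV dW hdW) rfl (complexConj_imagUnit L) (imagUnit_ne_zero L) (archKPlace L e dV hdV dW hdW v₀ u) v
    (archAt_archKPlace_sign_separated L e dV hdV dW hdW v₀ u hdef v)
  rw [show MpS.vac (sectionD L e dV hdV hdV0 dW hdW hdW0 (archKPlace L e dV hdV dW hdW v₀ u)) = _ from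
    vac_archWeilSectionS_of_kV L (IsCMField.complexConj L) (n + n) (IsCMField.complexConj_ne_one L) (cmPlaceOver L)
      (cmPlaceOver_smul L) (cmPlaceOver_comap L) (entryD L e dV hdV dW hdW)
      (gramD_gram_realDiagonal_entry_ne_zero L e dV hdV dW hdW hdV0 hdW0) (gramD_eq_diagonal_cm L e dV hdV dW hdW)
      (J := hermD L e dV hdV dW hdW) rfl (complexConj_imagUnit L) (imagUnit_ne_zero L) (archKPlace L e dV hdV dW hdW v₀ u)
      (fun v => (k v).1) (fun v => (k v).2) (fun v => hk v)]
  congr 1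
  rw [Finset.prod_eq_single v₀]
  · rw [hk2 v₀]; exact det_negSubmatrix_archKPlace_of_neg L e dV hdV hdV0 dW hdW hdW0 v₀ u hneg
  · intro v _ hv; rw [hk2 v]; exact det_negSubmatrix_archKPlace_of_ne L e dV hdV dW hdW v₀ u hv
  · intro h; exact absurd (Finset.mem_univ v₀) h

end Literature.NumberTheory.GelbartRogawski1991.GRConstruction

end
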